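import Summits.QuantumFields.YangMills.Theorems.BalabanUVNodesN19MGFRoadLiveSelector
import Summits.QuantumFields.YangMills.Theorems.BalabanUVNodesN19MGFFormKernelChainRStep

/-!
# BalabanUVNodes ∕ N19 — the MGF road at the LIVE selector of record, II: the R-step at a DEGENERATE selector (one whose moved sequences are non-live for the
# reference family) is the identity selector's t-free `{0,1}`-multiplier — moved sequences get `0`, fixed ones are R-stepped as at `ppSelIdOfRecord`, and a
# dressed∕vacuum POINTWISE SANDWICH PERSISTS through the R-step of record; all of it DISCHARGED at `ppSelLiveOfRecord` on F3's tower

Cell `pub-ymgap` (HUMAN RULING D-0062, Track A), node N19 = NE7, R134 seat `pub-ymgap-dag-n19-c` (g6); sibling of `Thm/BalabanUVNodesN19MGFRoadLiveSelector.lean`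
(same filing: the FOURTH piece of dag-lead's REBALANCE №65, WORDS-132 (2), dag-n19-d YIELD-21 ACK l.16005); lens `ym-lens-BalabanUVNodes-decomp` v5 ROW MF-ID ∕ M20.
Consumes BY NAME dag-n19-e g7's generic MF-R module `Thm/BalabanUVNodesN19MGFFormKernelChainRStep.lean` (p490454: `rratio_self_eq_ite`, `rratio_self_reslot_eq`,
`self_div_eq_of_sandwich` — the identity-selector algebra, lens v5 sketch §3 lifted there; NOT restated) and K0a's `rstepOfSel_id_TexpA`.  Filed `--supports` K3‴
«SpineGivenEndpointR13» (stmt-QuantumFields-19912) `--as helper`.  COUNT-NEUTRAL.  THEOREMS ONLY (0 `def`); no Theses import; general `N`; edits nothing.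

WHAT IS PROVED ([folklore] ∕ bookkeeping; [Balaban1989LargeFieldI] (0.3) p. 176 re-indexed by sequences = def-R's `rstepOfSel_TexpA`:
`(𝐓e^A)′(a′) = (𝐓e^A)(a′)·Σ_{a : sel a = a′} ∫⌈_{fib a}t_a ∕ ∫⌈_{fib a}t_{a′}`; p. 177 «the actual procedure is more complicated» = the selector is RESIDUAL data).
* §5 GENERIC over def-R's `Step.Repr218` — a reference representation `r`, the re-slotted one `{ r with TexpA := T′ }` (same sequences, characters, fibres; e.g.
  F3's vacuum and dressed pre-𝐑 families), ANY selector `sel`: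
  – the `ite` face `rstepOfSel_reslot_TexpA_of_null_moved` (term sandwich `0 < m`, moved points with null reference own fibre integral ⇒
    `(R_sel T′)(a′)(V) = T′(a′)(V)·(sel a′ = a′ ? [∫⌈t_{a′}(V) ≠ 0] : 0)` — dag-n19-e's `rstepOfSel_id_reslot_TexpA` is the case `sel = id`) and its pointwise-sandwich
    form `…_of_slot_sandwich_of_null_moved` (§1 of the sibling: no measurability, no bound);
  – the `if`-free faces the record consumes: term sandwich from a pointwise slot sandwich (`rterm_reslot_sandwich_of_pointwise`), re-slotted numerator null where
    the reference identity-step is null (`fibreIntegral_rterm_reslot_eq_zero_of_null`, by B16RLeaf's «not live ⇒ dead», cited), (G-A) MOVED ⇒ `0` (`rstepOfSel_reslot_TexpA_eq_zero_of_sel_ne`),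
    (G-B) FIXED ⇒ as at `id` (`rstepOfSel_reslot_TexpA_eq_id_of_sel_eq`), (G-D) the identity-selector R-step PRESERVES `m·T ≤ T′ ≤ M·T` (`rstepOfSel_id_reslot_sandwich`:
    both sides are their slot times ONE `{0,1}`-valued function, the reference own ratio — `rratio_self_reslot_eq`), (G-E) so does the R-step at a degenerate selector
    (`rstepOfSel_reslot_sandwich_of_moved_null`).
  – OF RECORD, INSTANCE-FREE (TS-8: «null reference own fibre integral at `a`» is said `¬ LiveSeq … P₀ a`, K0a's predicate; bridges `unfold rstepSlot; exact`, every
    instance def-R's own by unification): for slot families `P₀` (reference) and `P` with `m·P₀ ≤ P ≤ M·P₀` pointwise (`0 < m`, `0 ≤ M`) and a selector whose moved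
    points are non-live for `P₀` — (A) `rstepSlot_eq_zero_of_sel_ne`, (B) `rstepSlot_eq_rstepSlot_id_of_sel_eq` (so dag-n19-d's identity-selector faces hold verbatim at
    fixed points), (D) `rstepSlot_id_sandwich`, (E) ★ `rstepSlot_sandwich_of_moved_not_liveSeq` — the R-HALF OF THE DRESSED∕VACUUM DOMINATION INDUCTION at every
    degenerate selector of record, no measurability, no bound.
* §6 ★ AT THE LIVE SELECTOR OF RECORD on F3's tower (tuple `ϑ` with `ϑ.ppSel = ppSelLiveOfRecord E (wOfRecord₉ ϑ)`, any datum `D`, `g 0 = g₀ p.K`; reference =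
  F3's VACUUM pre-𝐑 family `tstepOfRecord … (dressedSlotsOfDatum₉ ϑ D g₀ os 0 p g k)`, by the sibling's §4): the moved sequences are non-live
  (`not_liveSeq_vacuum_preR_of_ppSel_ne`); a dominated level-(k+1) family `P` (e.g. the DRESSED pre-𝐑 family, constants `e^{∓|t|}` from the at-record module) has
  `(𝐑 P)(s) ≡ 0` at moved `s` (`rstepSlotOfRecord_eq_zero_of_ppSelLive_ne`) and is R-stepped as at `ppSelIdOfRecord` at fixed `s`
  (`rstepSlotOfRecord_eq_id_of_ppSelLive_eq`); and ★ `dressedSlotsOfDatum₉_succ_sandwich_of_ppSelLive`: if the level-(k+1) dressed pre-𝐑 family is sandwiched by the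
  vacuum one then so are F3's level-(k+1) post-𝐑 slots `dressedSlotsOfDatum₉ … t … (k+1)` by `dressedSlotsOfDatum₉ … 0 … (k+1)` — the induction step dag-n19-d's
  `…_of_ppSelLive` re-key needs, with the same constants.

HONEST FRAMING.  Finite-sum algebra and order arithmetic on def-R's ∕ def-T's ∕ F3's OBJECTS; the dressed∕vacuum sandwich of the PRE-𝐑 family (the T-half of the
induction, from `0 ≤ w`, `|prodObs| ≤ 1`) is a HYPOTHESIS here (dag-n19-d's module supplies it at `ppSelIdOfRecord`; its proof does not read the selector); `MGFForm`
at the live selector is NOT typed here; no estimate; nothing of Bałaban's instantiated; NE7 ∕ NE1′ NOT proved; N19 NOT discharged (0∕1); K3‴ NOT claimed; counts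
UNMOVED (typed 28∕28 · discharged 5∕27 · A 5∕28); one finite four-torus programme — NOT ℝ⁴, NOT OS, NOT a mass gap, NOT Clay.  0 `def`; 0 `sorry`; standard axioms.
-/

set_option autoImplicit false

noncomputable section

open MeasureTheory
open scoped BigOperators ENNReal

namespace Summit.QuantumFields.YangMills.BalabanUVNodes.N19MGFRoadLiveSelectorRStep

open Literature.MathematicalPhysics.QuantumFieldTheory.Balaban1983to89
open Literature.MathematicalPhysics.QuantumFieldTheory.Balaban1983to89.Node00
open Literature.MathematicalPhysics.QuantumFieldTheory.Balaban1983to89.B15.BasicStep (fibreIntegral)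
open Literature.MathematicalPhysics.QuantumFieldTheory.Balaban1983to89.B16RLeafRecord12AtLive (not_liveSeq_of_liveSelOfSlot_ne)
open Summit.QuantumFields.YangMills.BalabanUVNodes.N19MGFFormKernelChainRStep (rratio_self_reslot_eq rratio_self_eq_ite self_div_eq_of_sandwich)
open Summit.QuantumFields.YangMills.BalabanUVNodes.N19MGFRoadLiveSelector
open T4Continuum

/-! ## §5 (L3) The R-step at a DEGENERATE selector is the same t-free `{0,1}`-multiplier as at the identity (generic over def-R's `Step.Repr218`, then of record) -/

section Degenerate

variable {P : Params} {G : Type*} [GaugeGroup G] [MeasurableSpace G] [HaarData G] {j : ℕ}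

open Classical in
/-- **THE R-STEP AT A DEGENERATE SELECTOR.**  Same data as n19-e's `rstepOfSel_id_reslot_TexpA` (reference representation `r`, re-slotted family `T′` with the
term fibre integrals sandwiched, `0 < m`), but an ARBITRARY selector `sel` every MOVED point of which (`sel a ≠ a`) has NULL reference own fibre integral
`∫⌈_{fib a} t_a ≡ 0`: then every moved summand of (0.3) vanishes (its re-slotted numerator is squeezed to `0`), a fixed point keeps exactly its own ratio, and
`(R_sel T′)(a′)(V) = T′(a′)(V) · (sel a′ = a′ ? [∫⌈t_{a′}(V) ≠ 0] : 0)` — the REFERENCE indicator again, t-free.  At `sel = id` the hypothesis is void and this is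
n19-e's face; at K0a's live selector the hypothesis is B16RLeaf's `dead_of_liveSelOfSlot_ne` (§4 of the sibling transports it to F3's vacuum family). [cite: Balaban1989LargeFieldI, (0.3) p.176 and p.177 (bookkeeping)] -/
theorem rstepOfSel_reslot_TexpA_of_null_moved (iP iQ : DecidableEq (PBond P j)) (r : Step.Repr218 P G j) (T' : r.Adm → Density P j G)
    (sel : r.Adm → r.Adm) (fib : r.Adm → Finset (PBond P j)) {m M : ℝ} (hm : 0 < m)
    (hsand : ∀ a V, m * fibreIntegral (fib a) (rterm r a) V ≤ fibreIntegral (fib a) (rterm { r with TexpA := T' } a) V ∧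
      fibreIntegral (fib a) (rterm { r with TexpA := T' } a) V ≤ M * fibreIntegral (fib a) (rterm r a) V)
    (hmoved : ∀ a, sel a ≠ a → ∀ V, @fibreIntegral P j G _ _ _ iQ (fib a) (rterm r a) V = 0) (a' : r.Adm) (V : GaugeField P j G) :
    (rstepOfSel { r with TexpA := T' } sel fib).TexpA a' V
      = T' a' V * (if sel a' = a' then (if @fibreIntegral P j G _ _ _ iQ (fib a') (rterm r a') V = 0 then 0 else 1) else 0) := by
  -- the indicator (and `hmoved`) may be read with ANY instance `iQ` (TS-8): `DecidableEq` is a subsingleton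
  obtain rfl : iP = iQ := Subsingleton.elim _ _
  rw [rstepOfSel_TexpA]
  show T' a' V * ∑ a ∈ Finset.univ.filter (fun a : r.Adm => sel a = a'), rratio { r with TexpA := T' } fib a a' V = _
  congr 1
  -- a MOVED summand vanishes: its re-slotted numerator is squeezed to `0` by the null reference one
  have hzero : ∀ a, sel a = a' → a ≠ a' → rratio { r with TexpA := T' } fib a a' V = 0 := by
    intro a ha hne
    have hsa : sel a ≠ a := fun h => hne (h.symm.trans ha)
    have h0 : fibreIntegral (fib a) (rterm r a) V = 0 := hmoved a hsa V
    have hnum : fibreIntegral (fib a) (rterm { r with TexpA := T' } a) V = 0 := by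
      apply le_antisymm
      · have h := (hsand a V).2
        rw [h0, mul_zero] at h
        exact h
      · unfold fibreIntegral; exact ENNReal.toReal_nonneg
    unfold rratio
    rw [hnum, zero_div]
  by_cases hfix : sel a' = a'
  · have hsum : ∑ a ∈ Finset.univ.filter (fun a : r.Adm => sel a = a'), rratio { r with TexpA := T' } fib a a' V
        = rratio { r with TexpA := T' } fib a' a' V :=
      Finset.sum_eq_single_of_mem a' (Finset.mem_filter.mpr ⟨Finset.mem_univ _, hfix⟩)
        (fun a ha hne => hzero a (Finset.mem_filter.mp ha).2 hne)
    rw [if_pos hfix, hsum, rratio_self_reslot_eq iP r T' fib hm hsand a' V, rratio_self_eq_ite iP r fib a' V]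
  · rw [if_neg hfix]
    refine Finset.sum_eq_zero fun a ha => ?_
    have ha' : sel a = a' := (Finset.mem_filter.mp ha).2
    refine hzero a ha' fun h => hfix ?_
    subst h
    exact ha'

open Classical in
/-- **… FROM A POINTWISE SLOT SANDWICH** (no measurability, no bound): reference slots `0 ≤ T`, characters `0 ≤ χ`, re-slotted family `m·T ≤ T′ ≤ M·T` pointwise
(`0 < m`, `0 ≤ M`) ⇒ the term fibre integrals are sandwiched (§1 `fibreIntegral_sandwich_of_pointwise`) and the degenerate-selector face holds.
[cite: Balaban1989LargeFieldI, (0.3) p.176 (bookkeeping)] -/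
theorem rstepOfSel_reslot_TexpA_of_slot_sandwich_of_null_moved (iP iQ : DecidableEq (PBond P j)) (r : Step.Repr218 P G j)
    (T' : r.Adm → Density P j G) (sel : r.Adm → r.Adm) (fib : r.Adm → Finset (PBond P j)) (hχ0 : ∀ a V, 0 ≤ r.χ a V)
    {m M : ℝ} (hm : 0 < m) (hM : 0 ≤ M) (hlo : ∀ a V, m * r.TexpA a V ≤ T' a V) (hhi : ∀ a V, T' a V ≤ M * r.TexpA a V)
    (hmoved : ∀ a, sel a ≠ a → ∀ V, @fibreIntegral P j G _ _ _ iQ (fib a) (rterm r a) V = 0) (a' : r.Adm) (V : GaugeField P j G) :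
    (rstepOfSel { r with TexpA := T' } sel fib).TexpA a' V
      = T' a' V * (if sel a' = a' then (if @fibreIntegral P j G _ _ _ iQ (fib a') (rterm r a') V = 0 then 0 else 1) else 0) := by
  refine rstepOfSel_reslot_TexpA_of_null_moved iP iQ r T' sel fib (M := M) hm (fun a V => ?_) hmoved a' V
  refine fibreIntegral_sandwich_of_pointwise (fib a) hm hM (fun U => ?_) (fun U => ?_) V
  · show m * (r.χ a U * r.TexpA a U) ≤ r.χ a U * T' a U
    calc m * (r.χ a U * r.TexpA a U) = r.χ a U * (m * r.TexpA a U) := by ring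
      _ ≤ r.χ a U * T' a U := mul_le_mul_of_nonneg_left (hlo a U) (hχ0 a U)
  · show r.χ a U * T' a U ≤ M * (r.χ a U * r.TexpA a U)
    calc r.χ a U * T' a U ≤ r.χ a U * (M * r.TexpA a U) := mul_le_mul_of_nonneg_left (hhi a U) (hχ0 a U)
      _ = M * (r.χ a U * r.TexpA a U) := by ring

/-! ### `if`-free generic faces (the forms the record-level `unfold rstepSlot; exact …` bridges consume: every instance is def-R's, by unification) -/

variable (N : ℕ) [NeZero N]

/-- Term sandwich from a pointwise slot sandwich (`0 ≤ χ`; no measurability, no bound): the `hsand` hypothesis of the faces below and of n19-e's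
`rstepOfSel_id_reslot_TexpA`, from `m·T ≤ T′ ≤ M·T`. [folklore] -/
theorem rterm_reslot_sandwich_of_pointwise (iP : DecidableEq (PBond P j)) (r : Step.Repr218 P G j) (T' : r.Adm → Density P j G)
    (fib : r.Adm → Finset (PBond P j)) (hχ0 : ∀ a V, 0 ≤ r.χ a V) {m M : ℝ} (hm : 0 < m) (hM : 0 ≤ M)
    (hlo : ∀ a V, m * r.TexpA a V ≤ T' a V) (hhi : ∀ a V, T' a V ≤ M * r.TexpA a V) (a : r.Adm) (V : GaugeField P j G) :
    m * fibreIntegral (fib a) (rterm r a) V ≤ fibreIntegral (fib a) (rterm { r with TexpA := T' } a) V ∧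
      fibreIntegral (fib a) (rterm { r with TexpA := T' } a) V ≤ M * fibreIntegral (fib a) (rterm r a) V := by
  refine fibreIntegral_sandwich_of_pointwise (fib a) hm hM (fun U => ?_) (fun U => ?_) V
  · show m * (r.χ a U * r.TexpA a U) ≤ r.χ a U * T' a U
    calc m * (r.χ a U * r.TexpA a U) = r.χ a U * (m * r.TexpA a U) := by ring
      _ ≤ r.χ a U * T' a U := mul_le_mul_of_nonneg_left (hlo a U) (hχ0 a U)
  · show r.χ a U * T' a U ≤ M * (r.χ a U * r.TexpA a U)
    calc r.χ a U * T' a U ≤ r.χ a U * (M * r.TexpA a U) := mul_le_mul_of_nonneg_left (hhi a U) (hχ0 a U)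
      _ = M * (r.χ a U * r.TexpA a U) := by ring

/-- Under the term sandwich, a reference sequence whose identity-selector R-stepped slot vanishes identically (K0a's «non-live» in def-R's currency) has a
vanishing RE-SLOTTED numerator `∫⌈_{fib a} t′_a ≡ 0` (§2 for the reference one, then the upper bound). [cite: Balaban1989LargeFieldI, (0.3) p.176 (bookkeeping)] -/
theorem fibreIntegral_rterm_reslot_eq_zero_of_null (iP : DecidableEq (PBond P j)) (r : Step.Repr218 P (SU N) j)
    (T' : r.Adm → Density P j (SU N)) (fib : r.Adm → Finset (PBond P j)) {m M : ℝ}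
    (hsand : ∀ a V, m * fibreIntegral (fib a) (rterm r a) V ≤ fibreIntegral (fib a) (rterm { r with TexpA := T' } a) V ∧
      fibreIntegral (fib a) (rterm { r with TexpA := T' } a) V ≤ M * fibreIntegral (fib a) (rterm r a) V)
    {a : r.Adm} (hnull : ∀ V, (rstepOfSel r id fib).TexpA a V = 0) (V : GaugeField P j (SU N)) :
    fibreIntegral (fib a) (rterm { r with TexpA := T' } a) V = 0 := by
  have h0 := fibreIntegral_rterm_eq_zero_of_rstepOfSel_id_null iP r fib hnull V
  apply le_antisymm
  · have h := (hsand a V).2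
    rw [h0, mul_zero] at h
    exact h
  · unfold fibreIntegral; exact ENNReal.toReal_nonneg

open Classical in
/-- **(G-A) A MOVED SEQUENCE HAS ZERO R-STEPPED RE-SLOTTED SLOT** — reference `r`, re-slotted `T′` (term sandwich, `0 < m`), selector whose moved points are null
for `r` (identity-selector R-step `≡ 0`): `sel a′ ≠ a′ ⇒ (R_sel T′)(a′) ≡ 0`. [cite: Balaban1989LargeFieldI, (0.3) p.176 and p.177 (bookkeeping)] -/
theorem rstepOfSel_reslot_TexpA_eq_zero_of_sel_ne (iP : DecidableEq (PBond P j)) (r : Step.Repr218 P (SU N) j)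
    (T' : r.Adm → Density P j (SU N)) (sel : r.Adm → r.Adm) (fib : r.Adm → Finset (PBond P j)) {m M : ℝ}
    (hsand : ∀ a V, m * fibreIntegral (fib a) (rterm r a) V ≤ fibreIntegral (fib a) (rterm { r with TexpA := T' } a) V ∧
      fibreIntegral (fib a) (rterm { r with TexpA := T' } a) V ≤ M * fibreIntegral (fib a) (rterm r a) V)
    (hmoved : ∀ a, sel a ≠ a → ∀ V, (rstepOfSel r id fib).TexpA a V = 0) {a' : r.Adm} (hs : sel a' ≠ a') (V : GaugeField P j (SU N)) :
    (rstepOfSel { r with TexpA := T' } sel fib).TexpA a' V = 0 := by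
  rw [rstepOfSel_TexpA]
  refine mul_eq_zero_of_right _ (Finset.sum_eq_zero fun a ha => ?_)
  have ha' : sel a = a' := (Finset.mem_filter.mp ha).2
  have hne : sel a ≠ a := by
    intro h
    have has : a = a' := h.symm.trans ha'
    subst has
    exact hs h
  show fibreIntegral (fib a) (rterm { r with TexpA := T' } a) V / _ = 0
  rw [fibreIntegral_rterm_reslot_eq_zero_of_null N iP r T' fib hsand (hmoved a hne) V, zero_div]

open Classical in
/-- **(G-B) A FIXED SEQUENCE IS R-STEPPED AS AT THE IDENTITY SELECTOR**: `sel a′ = a′ ⇒ (R_sel T′)(a′) = (R_id T′)(a′)` (the moved summands of (0.3) at `a′`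
vanish by (G-A)'s mechanism; the own summand is the identity selector's). [cite: Balaban1989LargeFieldI, (0.3) p.176 and p.177 (bookkeeping)] -/
theorem rstepOfSel_reslot_TexpA_eq_id_of_sel_eq (iP : DecidableEq (PBond P j)) (r : Step.Repr218 P (SU N) j)
    (T' : r.Adm → Density P j (SU N)) (sel : r.Adm → r.Adm) (fib : r.Adm → Finset (PBond P j)) {m M : ℝ}
    (hsand : ∀ a V, m * fibreIntegral (fib a) (rterm r a) V ≤ fibreIntegral (fib a) (rterm { r with TexpA := T' } a) V ∧
      fibreIntegral (fib a) (rterm { r with TexpA := T' } a) V ≤ M * fibreIntegral (fib a) (rterm r a) V)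
    (hmoved : ∀ a, sel a ≠ a → ∀ V, (rstepOfSel r id fib).TexpA a V = 0) {a' : r.Adm} (hs : sel a' = a') (V : GaugeField P j (SU N)) :
    (rstepOfSel { r with TexpA := T' } sel fib).TexpA a' V = (rstepOfSel { r with TexpA := T' } id fib).TexpA a' V := by
  rw [rstepOfSel_TexpA, rstepOfSel_TexpA]
  congr 1
  have hid : Finset.univ.filter (fun a : r.Adm => id a = a') = {a'} := by
    ext a; simp only [Finset.mem_filter, Finset.mem_univ, true_and, id_eq, Finset.mem_singleton]
  rw [hid, Finset.sum_singleton]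
  refine Finset.sum_eq_single_of_mem a' (Finset.mem_filter.mpr ⟨Finset.mem_univ _, hs⟩) fun a ha hne => ?_
  have ha' : sel a = a' := (Finset.mem_filter.mp ha).2
  have hsa : sel a ≠ a := fun h => hne (h.symm.trans ha')
  show fibreIntegral (fib a) (rterm { r with TexpA := T' } a) V / _ = 0
  rw [fibreIntegral_rterm_reslot_eq_zero_of_null N iP r T' fib hsand (hmoved a hsa) V, zero_div]

open Classical in
/-- **(G-D) THE IDENTITY-SELECTOR R-STEP PRESERVES THE SANDWICH**: `m·T ≤ T′ ≤ M·T` pointwise (`0 ≤ χ`, `0 < m`, `0 ≤ M`) ⇒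
`m·(R_id T)(a) ≤ (R_id T′)(a) ≤ M·(R_id T)(a)` — both are their slot times ONE `{0,1}`-valued function, the reference own ratio (n19-e's `rratio_self_reslot_eq`).
[cite: Balaban1989LargeFieldI, (0.3) p.176 (bookkeeping)] -/
theorem rstepOfSel_id_reslot_sandwich (iP : DecidableEq (PBond P j)) (r : Step.Repr218 P (SU N) j) (T' : r.Adm → Density P j (SU N))
    (fib : r.Adm → Finset (PBond P j)) (hχ0 : ∀ a V, 0 ≤ r.χ a V) {m M : ℝ} (hm : 0 < m) (hM : 0 ≤ M)
    (hlo : ∀ a V, m * r.TexpA a V ≤ T' a V) (hhi : ∀ a V, T' a V ≤ M * r.TexpA a V) (a : r.Adm) (V : GaugeField P j (SU N)) :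
    m * (rstepOfSel r id fib).TexpA a V ≤ (rstepOfSel { r with TexpA := T' } id fib).TexpA a V ∧
      (rstepOfSel { r with TexpA := T' } id fib).TexpA a V ≤ M * (rstepOfSel r id fib).TexpA a V := by
  have hsand := rterm_reslot_sandwich_of_pointwise iP r T' fib hχ0 hm hM hlo hhi
  rw [rstepOfSel_id_TexpA N iP, rstepOfSel_id_TexpA N iP, rratio_self_reslot_eq iP r T' fib hm hsand a V]
  have hr : 0 ≤ rratio r fib a a V := by
    unfold rratio fibreIntegral; exact div_nonneg ENNReal.toReal_nonneg ENNReal.toReal_nonneg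
  show m * (r.TexpA a V * _) ≤ T' a V * _ ∧ T' a V * _ ≤ M * (r.TexpA a V * _)
  constructor
  · rw [← mul_assoc]; exact mul_le_mul_of_nonneg_right (hlo a V) hr
  · rw [← mul_assoc]; exact mul_le_mul_of_nonneg_right (hhi a V) hr

/-- **(G-E) THE R-STEP AT A DEGENERATE SELECTOR PRESERVES THE SANDWICH**: `m·T ≤ T′ ≤ M·T` pointwise, moved points null for `r` ⇒
`m·(R_sel T)(a) ≤ (R_sel T′)(a) ≤ M·(R_sel T)(a)` for every `a` (fixed: (G-B) + (G-D); moved: `0 ≤ 0 ≤ 0` by (G-A), applied to `T′` and to `T` itself).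
[cite: Balaban1989LargeFieldI, (0.3) p.176 and p.177 (bookkeeping)] -/
theorem rstepOfSel_reslot_sandwich_of_moved_null (iP : DecidableEq (PBond P j)) (r : Step.Repr218 P (SU N) j) (T' : r.Adm → Density P j (SU N))
    (sel : r.Adm → r.Adm) (fib : r.Adm → Finset (PBond P j)) (hχ0 : ∀ a V, 0 ≤ r.χ a V) {m M : ℝ} (hm : 0 < m) (hM : 0 ≤ M)
    (hlo : ∀ a V, m * r.TexpA a V ≤ T' a V) (hhi : ∀ a V, T' a V ≤ M * r.TexpA a V)
    (hmoved : ∀ a, sel a ≠ a → ∀ V, (rstepOfSel r id fib).TexpA a V = 0) (a : r.Adm) (V : GaugeField P j (SU N)) :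
    m * (rstepOfSel r sel fib).TexpA a V ≤ (rstepOfSel { r with TexpA := T' } sel fib).TexpA a V ∧
      (rstepOfSel { r with TexpA := T' } sel fib).TexpA a V ≤ M * (rstepOfSel r sel fib).TexpA a V := by
  have hsand := rterm_reslot_sandwich_of_pointwise iP r T' fib hχ0 hm hM hlo hhi
  -- the reference representation is its own re-slotting, with constants `1, 1`
  have hsand₀ := rterm_reslot_sandwich_of_pointwise iP r r.TexpA fib hχ0 one_pos zero_le_one
    (fun a V => by rw [one_mul]) (fun a V => by rw [one_mul])
  by_cases hs : sel a = a
  · rw [rstepOfSel_reslot_TexpA_eq_id_of_sel_eq N iP r T' sel fib hsand hmoved hs V]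
    -- the same for the reference family (`{ r with TexpA := r.TexpA }` is `r` by structure eta)
    have h₀ : (rstepOfSel r sel fib).TexpA a V = (rstepOfSel r id fib).TexpA a V :=
      rstepOfSel_reslot_TexpA_eq_id_of_sel_eq N iP r r.TexpA sel fib hsand₀ hmoved hs V
    rw [h₀]
    exact rstepOfSel_id_reslot_sandwich N iP r T' fib hχ0 hm hM hlo hhi a V
  · rw [rstepOfSel_reslot_TexpA_eq_zero_of_sel_ne N iP r T' sel fib hsand hmoved hs V]
    have h₀ : (rstepOfSel r sel fib).TexpA a V = 0 :=
      rstepOfSel_reslot_TexpA_eq_zero_of_sel_ne N iP r r.TexpA sel fib hsand₀ hmoved hs V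
    rw [h₀, mul_zero, mul_zero]
    exact ⟨le_rfl, le_rfl⟩

variable (F : T4Family) (ν : Stage7Numerics) (τ : TowerNumerics) {p : B12.RunParams} {g : ℕ → ℝ} {k : ℕ}

/-! ### Of record — INSTANCE-FREE faces (TS-8: nothing instance-bearing is displayed; «null own fibre integral of the reference term at `a`» is said as
`¬ LiveSeq … P₀ a`, K0a's predicate — §2 shows it implies (indeed is equivalent to) the vanishing; the bridges are `unfold rstepSlot; exact`, every
instance def-R's own, by unification) -/

/-- K0a's `¬ LiveSeq` in def-R's currency: the identity-selector R-step of record vanishes identically. [cite: Balaban1989LargeFieldI, (0.3) p.176 (bookkeeping)] -/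
theorem rstepSlot_id_eq_zero_of_not_liveSeq (f : TexpASlot F N ν τ.M p g k) {s : SeqOfRecord F ν τ.M g p.K k}
    (hs : ¬ LiveSeq F N ν τ p g k f s) (V : GaugeField (F.P p.K) k (SU N)) : rstepSlot F N ν τ p g k id f s V = 0 := by
  by_contra h
  exact hs ⟨V, h⟩

/-- **OF RECORD (A): A MOVED SEQUENCE HAS ZERO R-STEPPED SLOT.**  Two slot families at one level, a REFERENCE `P₀` and a `P` with `m·P₀ ≤ P ≤ M·P₀` pointwise
(`0 < m`, `0 ≤ M`), and a selector every MOVED point of which is NON-LIVE for `P₀`: `sel s ≠ s ⇒ (R_sel P)(s) ≡ 0`.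
[cite: Balaban1989LargeFieldI, (0.3) p.176 and p.177 (bookkeeping)] -/
theorem rstepSlot_eq_zero_of_sel_ne (sel : SeqOfRecord F ν τ.M g p.K k → SeqOfRecord F ν τ.M g p.K k) (P₀ P : TexpASlot F N ν τ.M p g k)
    {m M : ℝ} (hm : 0 < m) (hM : 0 ≤ M) (hlo : ∀ a U, m * P₀ a U ≤ P a U) (hhi : ∀ a U, P a U ≤ M * P₀ a U)
    (hmoved : ∀ a, sel a ≠ a → ¬ LiveSeq F N ν τ p g k P₀ a) {s : SeqOfRecord F ν τ.M g p.K k} (hs : sel s ≠ s)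
    (V : GaugeField (F.P p.K) k (SU N)) : rstepSlot F N ν τ p g k sel P s V = 0 := by
  have hmoved' : ∀ a, sel a ≠ a → ∀ W, rstepSlot F N ν τ p g k id P₀ a W = 0 :=
    fun a ha W => rstepSlot_id_eq_zero_of_not_liveSeq N F ν τ P₀ (hmoved a ha) W
  unfold rstepSlot at hmoved' ⊢
  exact rstepOfSel_reslot_TexpA_eq_zero_of_sel_ne N _ (sliceOfRecord F N ν τ.M p g k P₀) P sel (fibOfSeq F ν τ p g k)
    (rterm_reslot_sandwich_of_pointwise _ (sliceOfRecord F N ν τ.M p g k P₀) P (fibOfSeq F ν τ p g k)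
      (fun a W => chiSeqOfRecord_nonneg F N ν τ.M g p.K k a W) hm hM hlo hhi) hmoved' hs V

/-- **OF RECORD (B): A FIXED SEQUENCE IS R-STEPPED AS AT `ppSelIdOfRecord`**: `sel s = s ⇒ (R_sel P)(s) = (R_id P)(s)` — so the companion at-record module's
identity-selector faces (dag-n19-d's `rstepSlot_id_apply`) hold verbatim at every fixed point of a degenerate selector.
[cite: Balaban1989LargeFieldI, (0.3) p.176 and p.177 (bookkeeping)] -/
theorem rstepSlot_eq_rstepSlot_id_of_sel_eq (sel : SeqOfRecord F ν τ.M g p.K k → SeqOfRecord F ν τ.M g p.K k) (P₀ P : TexpASlot F N ν τ.M p g k)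
    {m M : ℝ} (hm : 0 < m) (hM : 0 ≤ M) (hlo : ∀ a U, m * P₀ a U ≤ P a U) (hhi : ∀ a U, P a U ≤ M * P₀ a U)
    (hmoved : ∀ a, sel a ≠ a → ¬ LiveSeq F N ν τ p g k P₀ a) {s : SeqOfRecord F ν τ.M g p.K k} (hs : sel s = s)
    (V : GaugeField (F.P p.K) k (SU N)) : rstepSlot F N ν τ p g k sel P s V = rstepSlot F N ν τ p g k id P s V := by
  have hmoved' : ∀ a, sel a ≠ a → ∀ W, rstepSlot F N ν τ p g k id P₀ a W = 0 :=
    fun a ha W => rstepSlot_id_eq_zero_of_not_liveSeq N F ν τ P₀ (hmoved a ha) W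
  unfold rstepSlot at hmoved' ⊢
  exact rstepOfSel_reslot_TexpA_eq_id_of_sel_eq N _ (sliceOfRecord F N ν τ.M p g k P₀) P sel (fibOfSeq F ν τ p g k)
    (rterm_reslot_sandwich_of_pointwise _ (sliceOfRecord F N ν τ.M p g k P₀) P (fibOfSeq F ν τ p g k)
      (fun a W => chiSeqOfRecord_nonneg F N ν τ.M g p.K k a W) hm hM hlo hhi) hmoved' hs V

/-- **OF RECORD (D): THE IDENTITY-SELECTOR R-STEP PRESERVES A POINTWISE SANDWICH**: `m·P₀ ≤ P ≤ M·P₀` ⇒ `m·(R_id P₀) ≤ R_id P ≤ M·(R_id P₀)` — the R-half of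
the dressed∕vacuum domination induction at `ppSelIdOfRecord`, no measurability, no bound. [cite: Balaban1989LargeFieldI, (0.3) p.176 (bookkeeping)] -/
theorem rstepSlot_id_sandwich (P₀ P : TexpASlot F N ν τ.M p g k) {m M : ℝ} (hm : 0 < m) (hM : 0 ≤ M)
    (hlo : ∀ a U, m * P₀ a U ≤ P a U) (hhi : ∀ a U, P a U ≤ M * P₀ a U) (s : SeqOfRecord F ν τ.M g p.K k) (V : GaugeField (F.P p.K) k (SU N)) :
    m * rstepSlot F N ν τ p g k id P₀ s V ≤ rstepSlot F N ν τ p g k id P s V ∧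
      rstepSlot F N ν τ p g k id P s V ≤ M * rstepSlot F N ν τ p g k id P₀ s V := by
  unfold rstepSlot
  exact rstepOfSel_id_reslot_sandwich N _ (sliceOfRecord F N ν τ.M p g k P₀) P (fibOfSeq F ν τ p g k)
    (fun a W => chiSeqOfRecord_nonneg F N ν τ.M g p.K k a W) hm hM hlo hhi s V

/-- **OF RECORD (E): THE R-STEP AT A DEGENERATE SELECTOR PRESERVES A POINTWISE SANDWICH**: reference `P₀`, dominated `P`, selector whose moved points are
non-live for `P₀` ⇒ `m·(R_sel P₀) ≤ R_sel P ≤ M·(R_sel P₀)` — the R-half of the domination induction at EVERY degenerate selector of record (identity: void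
hypothesis; live: §6). [cite: Balaban1989LargeFieldI, (0.3) p.176 and p.177 (bookkeeping)] -/
theorem rstepSlot_sandwich_of_moved_not_liveSeq (sel : SeqOfRecord F ν τ.M g p.K k → SeqOfRecord F ν τ.M g p.K k)
    (P₀ P : TexpASlot F N ν τ.M p g k) {m M : ℝ} (hm : 0 < m) (hM : 0 ≤ M)
    (hlo : ∀ a U, m * P₀ a U ≤ P a U) (hhi : ∀ a U, P a U ≤ M * P₀ a U) (hmoved : ∀ a, sel a ≠ a → ¬ LiveSeq F N ν τ p g k P₀ a)
    (s : SeqOfRecord F ν τ.M g p.K k) (V : GaugeField (F.P p.K) k (SU N)) :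
    m * rstepSlot F N ν τ p g k sel P₀ s V ≤ rstepSlot F N ν τ p g k sel P s V ∧
      rstepSlot F N ν τ p g k sel P s V ≤ M * rstepSlot F N ν τ p g k sel P₀ s V := by
  have hmoved' : ∀ a, sel a ≠ a → ∀ W, rstepSlot F N ν τ p g k id P₀ a W = 0 :=
    fun a ha W => rstepSlot_id_eq_zero_of_not_liveSeq N F ν τ P₀ (hmoved a ha) W
  unfold rstepSlot at hmoved' ⊢
  exact rstepOfSel_reslot_sandwich_of_moved_null N _ (sliceOfRecord F N ν τ.M p g k P₀) P sel (fibOfSeq F ν τ p g k)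
    (fun a W => chiSeqOfRecord_nonneg F N ν τ.M g p.K k a W) hm hM hlo hhi hmoved' s V

end Degenerate

/-! ## §6 AT THE LIVE SELECTOR OF RECORD: the R-step on F3's DRESSED pre-𝐑 family moves no mass, and the dressed∕vacuum sandwich persists -/

section LiveOfRecord

variable (F : T4Family) (N : ℕ) [NeZero N]

/-- **AT THE LIVE SELECTOR OF RECORD THE MOVED SEQUENCES ARE NON-LIVE FOR F3's VACUUM PRE-𝐑 FAMILY**: for `ϑ` pinned at the live selector of record, any datum,
`g 0 = g₀ p.K`: `ϑ.ppSel p g (k+1) s ≠ s → ¬ LiveSeq … (tstepOfRecord … (dressedSlotsOfDatum₉ ϑ D g₀ os 0 p g k)) s` (§4 + K0a `liveSelOfSlot_of_live`) — the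
degenerate-selector hypothesis of §5, DISCHARGED. [cite: Balaban1989LargeFieldI, (0.3) p.176 and p.177 (bookkeeping)] -/
theorem not_liveSeq_vacuum_preR_of_ppSel_ne (ϑ : Stage9Params F N) (E : B12.RunParams → ℝ)
    (hsel : ϑ.ppSel = ppSelLiveOfRecord F N ϑ.ν ϑ.τ9 E (wOfRecord₉ F N ϑ)) (D : FiniteEpsData F (SU N)) (g₀ : ℕ → ℝ) (os : List (ULoop F))
    (p : B12.RunParams) (g : ℕ → ℝ) (hg : g 0 = g₀ p.K) (k : ℕ) {s : SeqOfRecord F ϑ.ν ϑ.τ9.M g p.K (k + 1)}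
    (hs : ϑ.ppSel p g (k + 1) s ≠ s) :
    ¬ LiveSeq F N ϑ.ν ϑ.τ9 p g (k + 1) (tstepOfRecord F N ϑ.ν ϑ.τ9.M (wOfRecord₉ F N ϑ) p g k (dressedSlotsOfDatum₉ F N ϑ D g₀ os 0 p g k)) s := by
  refine not_liveSeq_of_liveSelOfSlot_ne _ ?_
  rw [← ppSelLiveOfRecord_succ_eq_liveSelOfSlot_dressed_zero F N ϑ E hsel D g₀ os p g hg k]
  rw [hsel] at hs
  exact hs

/-- **THE MGF ROAD's R-STEP AT THE LIVE SELECTOR OF RECORD, I — MOVED SEQUENCES CARRY NO DRESSED MASS**: for `ϑ` pinned at the live selector of record, any datum,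
`g 0 = g₀ p.K`, any level-(k+1) family `P` sandwiched by F3's vacuum pre-𝐑 family `P⁰ := tstepOfRecord … (dressedSlotsOfDatum₉ ϑ D g₀ os 0 p g k)` (`0 < m`,
`0 ≤ M`; the companion at-record module supplies `e^{∓|t|}` for the DRESSED pre-𝐑 family): `ϑ.ppSel … s ≠ s ⇒ (𝐑 P)(s) ≡ 0`.
[cite: Balaban1989LargeFieldI, (0.3) p.176 and p.177 (bookkeeping)] -/
theorem rstepSlotOfRecord_eq_zero_of_ppSelLive_ne (ϑ : Stage9Params F N) (E : B12.RunParams → ℝ)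
    (hsel : ϑ.ppSel = ppSelLiveOfRecord F N ϑ.ν ϑ.τ9 E (wOfRecord₉ F N ϑ)) (D : FiniteEpsData F (SU N)) (g₀ : ℕ → ℝ) (os : List (ULoop F))
    (p : B12.RunParams) (g : ℕ → ℝ) (hg : g 0 = g₀ p.K) (k : ℕ) (P : TexpASlot F N ϑ.ν ϑ.τ9.M p g (k + 1)) {m M : ℝ} (hm : 0 < m) (hM : 0 ≤ M)
    (hlo : ∀ s U, m * tstepOfRecord F N ϑ.ν ϑ.τ9.M (wOfRecord₉ F N ϑ) p g k (dressedSlotsOfDatum₉ F N ϑ D g₀ os 0 p g k) s U ≤ P s U)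
    (hhi : ∀ s U, P s U ≤ M * tstepOfRecord F N ϑ.ν ϑ.τ9.M (wOfRecord₉ F N ϑ) p g k (dressedSlotsOfDatum₉ F N ϑ D g₀ os 0 p g k) s U)
    {s : SeqOfRecord F ϑ.ν ϑ.τ9.M g p.K (k + 1)} (hs : ϑ.ppSel p g (k + 1) s ≠ s) (V : GaugeField (F.P p.K) (k + 1) (SU N)) :
    rstepSlotOfRecord F N ϑ.ν ϑ.τ9 ϑ.ppSel p g (k + 1) P s V = 0 :=
  rstepSlot_eq_zero_of_sel_ne N F ϑ.ν ϑ.τ9 (ϑ.ppSel p g (k + 1)) _ P hm hM hlo hhi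
    (fun _ ha => not_liveSeq_vacuum_preR_of_ppSel_ne F N ϑ E hsel D g₀ os p g hg k ha) hs V

/-- **… II — FIXED SEQUENCES ARE R-STEPPED AS AT `ppSelIdOfRecord`**: `ϑ.ppSel … s = s ⇒ (𝐑_{ϑ.ppSel} P)(s) = (𝐑_{id} P)(s)`, so dag-n19-d's identity-selector
faces (`rstepSlot_id_apply`: `= P(s)·[∫⌈ vacuum term ≠ 0]`) hold verbatim at the live selector's fixed points. [cite: Balaban1989LargeFieldI, (0.3) p.176 and p.177 (bookkeeping)] -/
theorem rstepSlotOfRecord_eq_id_of_ppSelLive_eq (ϑ : Stage9Params F N) (E : B12.RunParams → ℝ)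
    (hsel : ϑ.ppSel = ppSelLiveOfRecord F N ϑ.ν ϑ.τ9 E (wOfRecord₉ F N ϑ)) (D : FiniteEpsData F (SU N)) (g₀ : ℕ → ℝ) (os : List (ULoop F))
    (p : B12.RunParams) (g : ℕ → ℝ) (hg : g 0 = g₀ p.K) (k : ℕ) (P : TexpASlot F N ϑ.ν ϑ.τ9.M p g (k + 1)) {m M : ℝ} (hm : 0 < m) (hM : 0 ≤ M)
    (hlo : ∀ s U, m * tstepOfRecord F N ϑ.ν ϑ.τ9.M (wOfRecord₉ F N ϑ) p g k (dressedSlotsOfDatum₉ F N ϑ D g₀ os 0 p g k) s U ≤ P s U)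
    (hhi : ∀ s U, P s U ≤ M * tstepOfRecord F N ϑ.ν ϑ.τ9.M (wOfRecord₉ F N ϑ) p g k (dressedSlotsOfDatum₉ F N ϑ D g₀ os 0 p g k) s U)
    {s : SeqOfRecord F ϑ.ν ϑ.τ9.M g p.K (k + 1)} (hs : ϑ.ppSel p g (k + 1) s = s) (V : GaugeField (F.P p.K) (k + 1) (SU N)) :
    rstepSlotOfRecord F N ϑ.ν ϑ.τ9 ϑ.ppSel p g (k + 1) P s V = rstepSlot F N ϑ.ν ϑ.τ9 p g (k + 1) id P s V :=
  rstepSlot_eq_rstepSlot_id_of_sel_eq N F ϑ.ν ϑ.τ9 (ϑ.ppSel p g (k + 1)) _ P hm hM hlo hhi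
    (fun _ ha => not_liveSeq_vacuum_preR_of_ppSel_ne F N ϑ E hsel D g₀ os p g hg k ha) hs V

/-- **… III — THE DRESSED∕VACUUM SANDWICH PERSISTS THROUGH THE R-STEP OF RECORD** at the live selector: if the level-(k+1) DRESSED pre-𝐑 family
`tstepOfRecord … (dressedSlotsOfDatum₉ … t … k)` is sandwiched by the VACUUM one with constants `0 < m`, `0 ≤ M`, then so are the level-(k+1) post-𝐑 slots
`dressedSlotsOfDatum₉ … t … (k+1)` by `dressedSlotsOfDatum₉ … 0 … (k+1)` (`texpAOfRecordFrom_succ`) — the R-half of the domination induction at the LIVE selector,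
for dag-n19-d's `…_of_ppSelLive`. [cite: Balaban1989LargeFieldI, (0.3) p.176 (bookkeeping)] -/
theorem dressedSlotsOfDatum₉_succ_sandwich_of_ppSelLive (ϑ : Stage9Params F N) (E : B12.RunParams → ℝ)
    (hsel : ϑ.ppSel = ppSelLiveOfRecord F N ϑ.ν ϑ.τ9 E (wOfRecord₉ F N ϑ)) (D : FiniteEpsData F (SU N)) (g₀ : ℕ → ℝ) (os : List (ULoop F))
    (p : B12.RunParams) (g : ℕ → ℝ) (hg : g 0 = g₀ p.K) (k : ℕ) (t : ℝ) {m M : ℝ} (hm : 0 < m) (hM : 0 ≤ M)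
    (hlo : ∀ s U, m * tstepOfRecord F N ϑ.ν ϑ.τ9.M (wOfRecord₉ F N ϑ) p g k (dressedSlotsOfDatum₉ F N ϑ D g₀ os 0 p g k) s U
      ≤ tstepOfRecord F N ϑ.ν ϑ.τ9.M (wOfRecord₉ F N ϑ) p g k (dressedSlotsOfDatum₉ F N ϑ D g₀ os t p g k) s U)
    (hhi : ∀ s U, tstepOfRecord F N ϑ.ν ϑ.τ9.M (wOfRecord₉ F N ϑ) p g k (dressedSlotsOfDatum₉ F N ϑ D g₀ os t p g k) s U
      ≤ M * tstepOfRecord F N ϑ.ν ϑ.τ9.M (wOfRecord₉ F N ϑ) p g k (dressedSlotsOfDatum₉ F N ϑ D g₀ os 0 p g k) s U)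
    (s : SeqOfRecord F ϑ.ν ϑ.τ9.M g p.K (k + 1)) (V : GaugeField (F.P p.K) (k + 1) (SU N)) :
    m * dressedSlotsOfDatum₉ F N ϑ D g₀ os 0 p g (k + 1) s V ≤ dressedSlotsOfDatum₉ F N ϑ D g₀ os t p g (k + 1) s V ∧
      dressedSlotsOfDatum₉ F N ϑ D g₀ os t p g (k + 1) s V ≤ M * dressedSlotsOfDatum₉ F N ϑ D g₀ os 0 p g (k + 1) s V := by
  show m * texpAOfRecordFrom F N ϑ.ν ϑ.τ9.M _ _ _ p g (k + 1) s V ≤ texpAOfRecordFrom F N ϑ.ν ϑ.τ9.M _ _ _ p g (k + 1) s V ∧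
    texpAOfRecordFrom F N ϑ.ν ϑ.τ9.M _ _ _ p g (k + 1) s V ≤ M * texpAOfRecordFrom F N ϑ.ν ϑ.τ9.M _ _ _ p g (k + 1) s V
  rw [texpAOfRecordFrom_succ, texpAOfRecordFrom_succ]
  exact rstepSlot_sandwich_of_moved_not_liveSeq N F ϑ.ν ϑ.τ9 (ϑ.ppSel p g (k + 1)) _ _ hm hM hlo hhi
    (fun _ ha => not_liveSeq_vacuum_preR_of_ppSel_ne F N ϑ E hsel D g₀ os p g hg k ha) s V

end LiveOfRecord

end Summit.QuantumFields.YangMills.BalabanUVNodes.N19MGFRoadLiveSelectorRStep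

end
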